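import Summits.HubbardSuperconductivity.HubbardSuperconductivity.Theorems.AnisotropyChordInsertionEntropySheetCluster
import Summits.HubbardSuperconductivity.HubbardSuperconductivity.Theorems.AnisotropyChordInsertionEntropySheetCovariance

/-!
# Route `AnisotropyChord` / H0 rotor rung: THE VARIANCE ROUTE — `R8ᶜ` from the particle–hole floor and ONE
# fluctuation bound (port of theory seat `hubbard-h0-rotor-theory-1`, Sketch9 Part O (sheet half), memo
# ROTOR-THEORY-9 §135(s); tree currency)

For the canonical half-filled Jastrow–sheet state `halfSheetAmp L β`:
* `sheetPotential L β u σ = Σ_z W(z−u) n_z(σ)` — the potential felt at `u`; the crux **PF**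
  `SheetPotentialFluctuationBound β C_Φ` (`Var_μ(Φ_u) ≤ C_Φ` uniformly in `L ≥ 2`, `u`; = Debye screening in its
  weakest, quadratic form; OPEN);
* **`klDiv_halfSheet_le` (PROVED):** `KL(ν_x^{(y)} ‖ ν_y^{(x)}) = cov(1_A, X̃)/μ(A)` with the restricted dipole statistic
  `X̃ = Φ_y − Φ_x − W(x−y)(n_x − n_y)`, weighted Cauchy–Schwarz and `var X̃ ≤ 3(2C_Φ + β²)` give
  `KL ≤ (1 + 3(2C_Φ + β²)/c₀)/2` from T0 ∧ PF;
* `jelliumSheetEntropyBoundC_of_fluctuation` (T0 ∧ PF ⟹ R8ᶜ at half filling), `condensate_even_of_entropyBoundC`,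
  **`condensate_of_fluctuation`** (T0 ∧ PF at THAT `β` ⟹ `e^{−C/2}/4 ≤ n₀/|Λ|` for all even `L ≥ 2`) and the
  packaged small-`β` target `SheetFluctuationOutputs` with `condensate_of_sheetFluctuationOutputs`.
No three-point function, no `ε`, no pointwise decay anywhere in this chain.
-/

set_option linter.dupNamespace false

noncomputable section

open Finset
open Literature.Probability.LatticeModels

namespace Summit.HubbardSuperconductivity.HubbardSuperconductivity.Theorems.AnisotropyChord.InsertionEntropy

section SheetFluctuation

/-- `W(0) = c`. [folklore] -/
theorem sheetFun_at_zero (L : ℕ) [NeZero L] (β c : ℝ) : sheetFun L β c (0 : TorusSite 2 L) = c := by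
  unfold sheetFun; rw [if_pos rfl]

/-- `|W(v)| ≤ |β|` for the `c = 0` sheet kernel. (theory seat Sketch9 Part O) [folklore] -/
theorem abs_sheetFun_zero_le (L : ℕ) [NeZero L] (β : ℝ) (v : TorusSite 2 L) : |sheetFun L β 0 v| ≤ |β| := by
  unfold sheetFun
  split_ifs with hv
  · rw [abs_zero]; exact abs_nonneg β
  · have h1 := one_le_latDist_of_ne_zero L hv
    rw [abs_div, abs_of_pos (show (0 : ℝ) < (L : ℝ) / (2 * Real.pi) * torusNorm L v by linarith)]
    exact div_le_self (abs_nonneg β) h1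

/-- The potential felt at `u` from the particles: `Φ_u(σ) = Σ_z W(z − u) n_z(σ)` (`W(0) = 0`).
(theory seat Sketch9 Part O `sheetPotential`) [folklore] -/
def sheetPotential (L : ℕ) [NeZero L] (β : ℝ) (u : TorusSite 2 L) (σ : TorusSite 2 L → Fin 2) : ℝ :=
  ∑ z, sheetFun L β 0 (z - u) * occ σ z

/-- **PF — `SheetPotentialFluctuationBound β C_Φ` (bounded potential fluctuations = screening in its weakest,
quadratic form; OPEN):** `Var_μ(Φ_u) ≤ C_Φ` uniformly in `L ≥ 2` and `u`, for the canonical half-filled sheet gas at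
coupling `β` (`Var Φ_u = |Λ|⁻¹ Σ_{k≠0} Ŵ_L(k)² ĉ_L(k)`; unscreened it grows like `β² log L`).
[conjecture: theory seat hubbard-h0-rotor-theory-1, cycle 9, 2026-08-28 — Sketch9 Part O, memo ROTOR-THEORY-9 §135(s) (PF; OPEN; recommended rung crux, report 1t)] -/
def SheetPotentialFluctuationBound (β CΦ : ℝ) : Prop :=
  ∀ L : ℕ, ∀ [NeZero L], 2 ≤ L → ∀ u : TorusSite 2 L, wvar (halfSheetAmp L β) (sheetPotential L β u) ≤ CΦ

/-- `K² ≤ t ⇒ K ≤ (1 + t)/2`. [folklore] -/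
theorem le_half_of_sq_le (K t : ℝ) (ht : K ^ 2 ≤ t) : K ≤ (1 + t) / 2 := by nlinarith [sq_nonneg (K - 1)]

/-- **THE VARIANCE ROUTE (PROVED):** particle–hole floor `c₀` and potential-fluctuation bound `C_Φ` give
`KL(ν_x^{(y)} ‖ ν_y^{(x)}) ≤ (1 + 3(2C_Φ + β²)/c₀)/2` for the half-filled Jastrow–sheet state, every `L ≥ 2`, `x ≠ y`
(KL `= cov(1_A, X̃)/μ(A)`, `X̃ = Φ_y − Φ_x − W(x−y)(n_x − n_y)`, Cauchy–Schwarz, `var 1_A ≤ μ(A)`,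
`var X̃ ≤ 3(var Φ_y + var Φ_x + β²)`). (theory seat Sketch9 Part O `klDiv_halfSheet_le`) [folklore] -/
theorem klDiv_halfSheet_le (L : ℕ) [NeZero L] (β c₀ CΦ : ℝ) (hL : 2 ≤ L) (hc₀ : 0 < c₀)
    (hT0 : SheetParticleHoleFloor β c₀) (hPF : SheetPotentialFluctuationBound β CΦ)
    (x y : TorusSite 2 L) (hxy : x ≠ y) :
    klDiv (teleLaw (halfSheetAmp L β) x y) (teleLaw (halfSheetAmp L β) y x)
      ≤ (1 + 3 * (CΦ + CΦ + β ^ 2) / c₀) / 2 := by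
  have hM : 0 < pairMass (halfSheetAmp L β) x y := pairMass_halfSheetAmp_pos L β hL x y hxy
  have hZ : wnorm (halfSheetAmp L β) ≠ 0 := wnorm_halfSheetAmp_ne_zero L β hL
  have hZpos : 0 < wnorm (halfSheetAmp L β) := lt_of_le_of_ne (wnorm_nonneg _) (Ne.symm hZ)
  have hP : probPH (halfSheetAmp L β) x y = pairMass (halfSheetAmp L β) x y / wnorm (halfSheetAmp L β) :=
    probPH_eq _ x y hxy
  have hPpos : 0 < probPH (halfSheetAmp L β) x y := by rw [hP]; exact div_pos hM hZpos
  have hPc : c₀ ≤ probPH (halfSheetAmp L β) x y := hT0 L hL x y hxy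
  have hK0 : sheetFun L β 0 (0 : TorusSite 2 L) = 0 := sheetFun_at_zero L β 0
  -- KL as a cloud functional with `m = ρ_x`
  have hkl : klDiv (teleLaw (halfSheetAmp L β) x y) (teleLaw (halfSheetAmp L β) y x)
      = ∑ z, (condOcc (halfSheetAmp L β) x y z - dens (halfSheetAmp L β) x)
          * (sheetFun L β 0 (z - y) - sheetFun L β 0 (z - x)) :=
    klDiv_teleLaw_sheetSector_cloud L β 0 (L ^ 2 / 2) (jastrowSectorWeight_halfSheet_pos L β hL) x y _
  -- the restricted dipole field
  obtain ⟨ft, hft⟩ : ∃ ft : TorusSite 2 L → ℝ, ∀ z, ft z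
      = if z = x ∨ z = y then 0 else sheetFun L β 0 (z - y) - sheetFun L β 0 (z - x) := ⟨_, fun z => rfl⟩
  -- Step 1: KL = cov(1_A, X̃)/μ(A)
  have step1 : klDiv (teleLaw (halfSheetAmp L β) x y) (teleLaw (halfSheetAmp L β) y x)
      = wcov (halfSheetAmp L β) (fun σ => occ σ x * (1 - occ σ y)) (fun σ => ∑ z, ft z * occ σ z)
          / probPH (halfSheetAmp L β) x y := by
    rw [hkl]
    have hterm : ∀ z, (condOcc (halfSheetAmp L β) x y z - dens (halfSheetAmp L β) x)
          * (sheetFun L β 0 (z - y) - sheetFun L β 0 (z - x))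
        = ft z * wcov (halfSheetAmp L β) (fun σ => occ σ x * (1 - occ σ y)) (fun σ => occ σ z)
            / probPH (halfSheetAmp L β) x y
          + ((if z = x then -(dens (halfSheetAmp L β) x) * (sheetFun L β 0 (x - y) - sheetFun L β 0 0) else 0)
          + (if z = y then -(dens (halfSheetAmp L β) x) * (sheetFun L β 0 0 - sheetFun L β 0 (y - x)) else 0)) := by
      intro z
      by_cases hzx : z = x
      · rw [hzx, hft x, if_pos (Or.inl rfl), if_pos rfl, if_neg hxy, condOcc_self_left, sub_self]
        ring
      · by_cases hzy : z = y
        · rw [hzy, hft y, if_pos (Or.inr rfl), if_neg (Ne.symm hxy), if_pos rfl, condOcc_self_right, sub_self]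
          ring
        · rw [hft z, if_neg (not_or.mpr ⟨hzx, hzy⟩), if_neg hzx, if_neg hzy, add_zero,
            ← dens_halfSheet_const L β z x, condOcc_sub_dens_eq_wcov _ x y z hxy hzx hZ hM.ne']
          ring
    rw [Finset.sum_congr rfl fun z _ => hterm z, Finset.sum_add_distrib, Finset.sum_add_distrib,
      Finset.sum_ite_eq' Finset.univ x, Finset.sum_ite_eq' Finset.univ y]
    simp only [Finset.mem_univ, if_true]
    rw [← neg_sub x y, sheetFun_neg, wcov_sum_right, Finset.sum_div]
    ring
  -- Step 2: the dipole statistic as Φ_y − Φ_x − W(x−y)(n_x − n_y)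
  have hX : (fun σ : TorusSite 2 L → Fin 2 => ∑ z, ft z * occ σ z)
      = fun σ => sheetPotential L β y σ + (-1) * sheetPotential L β x σ
          + (-(sheetFun L β 0 (x - y))) * (occ σ x - occ σ y) := by
    funext σ
    unfold sheetPotential
    have hg : ∀ z, ft z * occ σ z
        = (sheetFun L β 0 (z - y) * occ σ z - sheetFun L β 0 (z - x) * occ σ z)
          - ((if z = x then (sheetFun L β 0 (x - y) - sheetFun L β 0 0) * occ σ x else 0)
          + (if z = y then (sheetFun L β 0 0 - sheetFun L β 0 (y - x)) * occ σ y else 0)) := by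
      intro z
      by_cases hzx : z = x
      · rw [hzx, hft x, if_pos (Or.inl rfl), if_pos rfl, if_neg hxy, sub_self]; ring
      · by_cases hzy : z = y
        · rw [hzy, hft y, if_pos (Or.inr rfl), if_neg (Ne.symm hxy), if_pos rfl, sub_self]; ring
        · rw [hft z, if_neg (not_or.mpr ⟨hzx, hzy⟩), if_neg hzx, if_neg hzy]; ring
    rw [Finset.sum_congr rfl fun z _ => hg z, Finset.sum_sub_distrib, Finset.sum_sub_distrib,
      Finset.sum_add_distrib, Finset.sum_ite_eq' Finset.univ x, Finset.sum_ite_eq' Finset.univ y]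
    simp only [Finset.mem_univ, if_true]
    rw [← neg_sub x y, sheetFun_neg, hK0]
    ring
  -- Step 3: var X̃ ≤ 3 (C_Φ + C_Φ + β²)
  have hvarX : wvar (halfSheetAmp L β) (fun σ => ∑ z, ft z * occ σ z) ≤ 3 * (CΦ + CΦ + β ^ 2) := by
    rw [hX]
    refine (wvar_add_three_le _ _ _ _ hZ).trans ?_
    have h1 : wvar (halfSheetAmp L β) (sheetPotential L β y) ≤ CΦ := hPF L hL y
    have h2 : wvar (halfSheetAmp L β) (fun σ => (-1) * sheetPotential L β x σ) ≤ CΦ := by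
      rw [wvar_smul]; have := hPF L hL x; nlinarith
    have h3 : wvar (halfSheetAmp L β) (fun σ => (-(sheetFun L β 0 (x - y))) * (occ σ x - occ σ y))
        ≤ β ^ 2 := by
      rw [wvar_smul, neg_sq]
      have hd : wvar (halfSheetAmp L β) (fun σ => occ σ x - occ σ y) ≤ 1 := by
        refine (wvar_le_wmean_sq _ _).trans (wmean_le_of_le _ 1 hZ fun σ => ?_)
        have hx := occ_mem_unit σ x
        have hy := occ_mem_unit σ y
        nlinarith [hx.1, hx.2, hy.1, hy.2]
      have hd0 : 0 ≤ wvar (halfSheetAmp L β) (fun σ => occ σ x - occ σ y) := wvar_nonneg _ _ hZ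
      have hK2 : sheetFun L β 0 (x - y) ^ 2 ≤ β ^ 2 := sq_le_sq.mpr (abs_sheetFun_zero_le L β (x - y))
      calc sheetFun L β 0 (x - y) ^ 2 * wvar (halfSheetAmp L β) (fun σ => occ σ x - occ σ y)
          ≤ sheetFun L β 0 (x - y) ^ 2 * 1 := mul_le_mul_of_nonneg_left hd (sq_nonneg _)
        _ ≤ β ^ 2 := by linarith
    linarith
  -- Step 4: Cauchy–Schwarz
  rw [step1]
  have hcs := wcov_sq_le_wvar_mul_wvar (halfSheetAmp L β) (fun σ => occ σ x * (1 - occ σ y))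
    (fun σ => ∑ z, ft z * occ σ z) hZ
  have hvarA := wvar_probPH_le (halfSheetAmp L β) x y
  have hvarX0 : 0 ≤ wvar (halfSheetAmp L β) (fun σ => ∑ z, ft z * occ σ z) := wvar_nonneg _ _ hZ
  have hK2 : (wcov (halfSheetAmp L β) (fun σ => occ σ x * (1 - occ σ y)) (fun σ => ∑ z, ft z * occ σ z)
        / probPH (halfSheetAmp L β) x y) ^ 2 ≤ 3 * (CΦ + CΦ + β ^ 2) / c₀ := by
    rw [div_pow]
    calc _ ≤ probPH (halfSheetAmp L β) x y * wvar (halfSheetAmp L β) (fun σ => ∑ z, ft z * occ σ z)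
            / probPH (halfSheetAmp L β) x y ^ 2 :=
          div_le_div_of_nonneg_right (hcs.trans (mul_le_mul_of_nonneg_right hvarA hvarX0)) (sq_nonneg _)
      _ = wvar (halfSheetAmp L β) (fun σ => ∑ z, ft z * occ σ z) / probPH (halfSheetAmp L β) x y := by
          rw [sq, mul_div_mul_left _ _ hPpos.ne']
      _ ≤ 3 * (CΦ + CΦ + β ^ 2) / probPH (halfSheetAmp L β) x y := div_le_div_of_nonneg_right hvarX hPpos.le
      _ ≤ 3 * (CΦ + CΦ + β ^ 2) / c₀ := by
          have hCΦ0 : 0 ≤ CΦ := (wvar_nonneg _ _ hZ).trans (hPF L hL x)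
          exact div_le_div_of_nonneg_left (by positivity) hc₀ hPc
  exact le_half_of_sq_le _ _ hK2

/-- **R8ᶜ at half filling from T0 + PF (PROVED).** (theory seat Sketch9 Part O `jelliumSheetEntropyBoundC_of_fluctuation`) [folklore] -/
theorem jelliumSheetEntropyBoundC_of_fluctuation (β c₀ CΦ : ℝ) (hc₀ : 0 < c₀)
    (hT0 : SheetParticleHoleFloor β c₀) (hPF : SheetPotentialFluctuationBound β CΦ) :
    JelliumSheetEntropyBoundC β 0 (fun L => L ^ 2 / 2) := by
  refine ⟨(1 + 3 * (CΦ + CΦ + β ^ 2) / c₀) / 2, fun L _ x y hxy _ => ?_⟩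
  exact klDiv_halfSheet_le L β c₀ CΦ (two_le_of_ne L x y hxy) hc₀ hT0 hPF x y hxy

/-- For even `L ≥ 2`, `⌊L²/2⌋/L² = ½`. [folklore] -/
theorem halfFilling_ratio_even (L : ℕ) (hL : 2 ≤ L) (hev : Even L) :
    ((L ^ 2 / 2 : ℕ) : ℝ) / (L : ℝ) ^ 2 = 1 / 2 := by
  obtain ⟨m, hm⟩ := hev
  have hLm : L = 2 * m := by omega
  have hdiv : L ^ 2 / 2 = 2 * m ^ 2 := by
    subst hLm
    have : (2 * m) ^ 2 = 2 * (2 * m ^ 2) := by ring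
    rw [this, Nat.mul_div_cancel_left _ (by norm_num : 0 < 2)]
  rw [hdiv, hLm]; push_cast
  have hm0 : (0 : ℝ) < (m : ℝ) := by
    have : 0 < m := by omega
    exact_mod_cast this
  field_simp

/-- **★′ with the ENTROPY BOUND as hypothesis, even `L ≥ 2`, half filling (PROVED):** floor `e^{−C/2}/4 ≤ n₀/|Λ|`.
(theory seat Sketch9 Part O `condensate_even_of_entropyBoundC`) [folklore] -/
theorem condensate_even_of_entropyBoundC (β : ℝ) (h : JelliumSheetEntropyBoundC β 0 (fun L => L ^ 2 / 2)) :
    ∃ C : ℝ, ∀ L : ℕ, ∀ [NeZero L], 2 ≤ L → Even L →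
      Real.exp (-C / 2) / 4 ≤ condensateDensity (halfSheetAmp L β) := by
  obtain ⟨C, hC⟩ := condensateDensity_sheetSector_ge_of_entropyBoundC' β 0 (fun L => L ^ 2 / 2) h
  refine ⟨C, fun L _ hL hev => ?_⟩
  have hsq : 4 ≤ L ^ 2 := by nlinarith
  have key : ((L ^ 2 / 2 : ℕ) : ℝ) / (L : ℝ) ^ 2 * (1 - ((L ^ 2 / 2 : ℕ) : ℝ) / (L : ℝ) ^ 2) * Real.exp (-C / 2)
      ≤ condensateDensity (halfSheetAmp L β) := hC L (by omega) (by omega)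
  rw [halfFilling_ratio_even L hL hev] at key
  have : (1 / 2 : ℝ) * (1 - 1 / 2) * Real.exp (-C / 2) = Real.exp (-C / 2) / 4 := by ring
  linarith [this ▸ key]

/-- **END-TO-END, VARIANCE ROUTE (PROVED):** particle–hole floor + bounded potential fluctuations ⟹ uniform BEC
(`e^{−C/2}/4 ≤ n₀/|Λ|`, all even `L ≥ 2`) of the half-filled Jastrow–sheet Rokhsar–Kivelson state, at THAT `β`
(no smallness of `β` enters the implication). (theory seat Sketch9 Part O `condensate_of_fluctuation`) [folklore] -/
theorem condensate_of_fluctuation (β c₀ CΦ : ℝ) (hc₀ : 0 < c₀)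
    (hT0 : SheetParticleHoleFloor β c₀) (hPF : SheetPotentialFluctuationBound β CΦ) :
    ∃ C : ℝ, ∀ L : ℕ, ∀ [NeZero L], 2 ≤ L → Even L →
      Real.exp (-C / 2) / 4 ≤ condensateDensity (halfSheetAmp L β) :=
  condensate_even_of_entropyBoundC β (jelliumSheetEntropyBoundC_of_fluctuation β c₀ CΦ hc₀ hT0 hPF)

/-- **`SheetFluctuationOutputs` (packaged small-`β` target; OPEN):** `∃ β₀ > 0, ∀ β ∈ (0, β₀]: T0 ∧ PF`.
[conjecture: theory seat hubbard-h0-rotor-theory-1, cycle 9, 2026-08-28 — Sketch9 Part O, memo ROTOR-THEORY-9 §135(s) (OPEN)] -/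
def SheetFluctuationOutputs : Prop :=
  ∃ β₀ : ℝ, 0 < β₀ ∧ ∀ β : ℝ, 0 < β → β ≤ β₀ → ∃ c₀ CΦ : ℝ, 0 < c₀ ∧
    SheetParticleHoleFloor β c₀ ∧ SheetPotentialFluctuationBound β CΦ

/-- `SheetFluctuationOutputs ⟹` uniform BEC of the half-filled Jastrow–sheet state for all small `β` (PROVED).
(theory seat Sketch9 Part O `condensate_of_sheetFluctuationOutputs`) [folklore] -/
theorem condensate_of_sheetFluctuationOutputs (h : SheetFluctuationOutputs) :
    ∃ β₀ : ℝ, 0 < β₀ ∧ ∀ β : ℝ, 0 < β → β ≤ β₀ → ∃ C : ℝ, ∀ L : ℕ, ∀ [NeZero L], 2 ≤ L → Even L →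
      Real.exp (-C / 2) / 4 ≤ condensateDensity (halfSheetAmp L β) := by
  obtain ⟨β₀, hβ₀, h⟩ := h
  refine ⟨β₀, hβ₀, fun β hβ hβ' => ?_⟩
  obtain ⟨c₀, CΦ, hc₀, hT0, hPF⟩ := h β hβ hβ'
  exact condensate_of_fluctuation β c₀ CΦ hc₀ hT0 hPF

end SheetFluctuation

end Summit.HubbardSuperconductivity.HubbardSuperconductivity.Theorems.AnisotropyChord.InsertionEntropy
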